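import Mathlib.Analysis.Calculus.Deriv.MeanValue
import Mathlib.Analysis.Calculus.Deriv.Polynomial
import Summits.Ventures.HSemireg.WedgeHankelRecurrenceGaussZerosSpread

/-!
# Venture HSemireg — **THE RATIO `q_{n+1}∕q_n` IS STRICTLY INCREASING BETWEEN THE ZEROS OF `q_n`** (and `q_n∕q_{n+1}` strictly decreasing between the zeros of `q_{n+1}`): the derivative of the
# ratio is the confluent Christoffel–Darboux sum `(q'_{n+1} q_n − q_{n+1} q'_n)∕q_n² > 0` (N274); consequently an interval free of zeros of `q_n` contains at most one zero of `q_{n+1}`, and an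
# interval free of zeros of `q_{n+1}` at most one zero of `q_n`

HONEST FRAMING. Part of the Lean index of the computation cell `pub-hsemireg` (seat p10 gen 44, Sunday typer «UNIFORM-IN-n»).  Real polynomials and one-variable calculus (`HasDerivAt`, the mean
value theorem through Mathlib `strictMonoOn_of_deriv_pos`) only; no variety, no cohomology theory, no sheaf, no Ext group and no semiregularity map is constructed here; nothing here says that
HC / HC_CM / HC_AV holds; no Literature fact (unproved `Prop`) is declared or used.  Custodian versions as in `WedgeHankelSiegelIdeal` (1/3).
SOURCES (cited).  G. Szegő, *Orthogonal Polynomials*, Thm 3.3.2 and its proof via (3.3.8) (`p_{n+1}∕p_n` increasing, hence the interlacing of the zeros); T. S. Chihara, *An Introduction to Orthogonal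
Polynomials* (1978) Ch. I Thm 5.3; E. B. Christoffel (1858) ∕ G. Darboux (1878) for the confluent kernel identity.
PROOF TYPED HERE.  `HasDerivAt` of the quotient of the two polynomial functions, positivity of the numerator by N274 `recurrence_christoffel_darboux_confluent_pos`, then Mathlib's
`strictMonoOn_of_deriv_pos` ∕ `strictAntiOn_of_deriv_neg` on a convex set avoiding the zeros of the denominator; uniqueness of a zero by strict monotonicity.
DEDUP DISCLOSURE (`rg -n 'StrictMonoOn|strictMonoOn|ratio_strictMono' Summits/Ventures/HSemireg`, 2026-09-03): N274 has the positivity of the confluent sum and N288 the partial fractions of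
`q_n∕q_{n+1}`; the monotonicity statements are new.  The 5 names below: 0 hits tree-wide.

WHAT IS IN THE TREE.  N274 `recurrence_christoffel_darboux_confluent_pos`; Mathlib `Polynomial.hasDerivAt`, `HasDerivAt.div`, `strictMonoOn_of_deriv_pos`, `strictAntiOn_of_deriv_neg`.
THIS FILE (namespace `Summit.Ventures.HSemireg.Wedge.HankelOuter` continued; CHAINED on N330 (import only), N274; 0 definitions):
* §1096 `hasDerivAt_recurrence_ratio` (the derivative of `q_{n+1}∕q_n`), **`recurrence_ratio_strictMonoOn`** (`q_{n+1}∕q_n` strictly increasing on every convex set free of zeros of `q_n`),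
  **`recurrence_inv_ratio_strictAntiOn`** (`q_n∕q_{n+1}` strictly decreasing on every convex set free of zeros of `q_{n+1}`), `recurrence_succ_zero_unique_of_convex` (at most one zero of
  `q_{n+1}` in such a set), `recurrence_zero_unique_of_convex` (at most one zero of `q_n` in a convex set free of zeros of `q_{n+1}`).
CAVEATS.  Positive recurrences (`b_j > 0`).  Nothing Ext-side.  New names only.
-/

open Module Polynomial
open scoped Matrix Polynomial

namespace Summit.Ventures.HSemireg.Wedge.HankelOuter

/-! ## §1096. Monotonicity of the ratio of consecutive members -/

/-- **The derivative of `q_{n+1}∕q_n` at a point where `q_n ≠ 0` is `(q'_{n+1} q_n − q'_n q_{n+1})∕q_n²`.** [calculus; this file, §1096] -/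
theorem hasDerivAt_recurrence_ratio (q : ℕ → ℝ[X]) (n : ℕ) {x : ℝ} (hx : (q n).eval x ≠ 0) :
    HasDerivAt (fun y => (q (n + 1)).eval y / (q n).eval y)
      (((derivative (q (n + 1))).eval x * (q n).eval x - (derivative (q n)).eval x * (q (n + 1)).eval x) / ((q n).eval x) ^ 2) x := by
  have h := ((q (n + 1)).hasDerivAt x).div ((q n).hasDerivAt x) hx
  have e : (derivative (q (n + 1))).eval x * (q n).eval x - (q (n + 1)).eval x * (derivative (q n)).eval x =
      (derivative (q (n + 1))).eval x * (q n).eval x - (derivative (q n)).eval x * (q (n + 1)).eval x := by ring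
  rw [e] at h
  exact h

/-- **`q_{n+1}∕q_n` IS STRICTLY INCREASING on every convex set on which `q_n` does not vanish** (positive recurrence). [Szegő Thm 3.3.2 ∕ (3.3.8); Chihara Ch. I Thm 5.3; this file, §1096] -/
theorem recurrence_ratio_strictMonoOn {q : ℕ → ℝ[X]} {a b : ℕ → ℝ} (hq0 : q 0 = 1) (hq1 : q 1 = Polynomial.X - C (a 0))
    (hrec : ∀ n, q (n + 2) = (Polynomial.X - C (a (n + 1))) * q (n + 1) - C (b (n + 1)) * q n) (hb : ∀ j, 0 < b j) (n : ℕ)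
    {S : Set ℝ} (hS : Convex ℝ S) (hSq : ∀ x ∈ S, (q n).eval x ≠ 0) :
    StrictMonoOn (fun y => (q (n + 1)).eval y / (q n).eval y) S := by
  refine strictMonoOn_of_deriv_pos hS ?_ fun x hx => ?_
  · exact ((q (n + 1)).continuous.continuousOn).div ((q n).continuous.continuousOn) hSq
  · have hxS : x ∈ S := interior_subset hx
    rw [(hasDerivAt_recurrence_ratio q n (hSq x hxS)).deriv]
    exact div_pos (recurrence_christoffel_darboux_confluent_pos hq0 hq1 hrec hb n x) (sq_pos_iff.2 (hSq x hxS))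

/-- **`q_n∕q_{n+1}` IS STRICTLY DECREASING on every convex set on which `q_{n+1}` does not vanish** (positive recurrence). [Szegő (3.3.8); this file, §1096] -/
theorem recurrence_inv_ratio_strictAntiOn {q : ℕ → ℝ[X]} {a b : ℕ → ℝ} (hq0 : q 0 = 1) (hq1 : q 1 = Polynomial.X - C (a 0))
    (hrec : ∀ n, q (n + 2) = (Polynomial.X - C (a (n + 1))) * q (n + 1) - C (b (n + 1)) * q n) (hb : ∀ j, 0 < b j) (n : ℕ)
    {S : Set ℝ} (hS : Convex ℝ S) (hSq : ∀ x ∈ S, (q (n + 1)).eval x ≠ 0) :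
    StrictAntiOn (fun y => (q n).eval y / (q (n + 1)).eval y) S := by
  refine strictAntiOn_of_deriv_neg hS ?_ fun x hx => ?_
  · exact ((q n).continuous.continuousOn).div ((q (n + 1)).continuous.continuousOn) hSq
  · have hxS : x ∈ S := interior_subset hx
    have h : HasDerivAt (fun y => (q n).eval y / (q (n + 1)).eval y)
        (((derivative (q n)).eval x * (q (n + 1)).eval x - (q n).eval x * (derivative (q (n + 1))).eval x) / ((q (n + 1)).eval x) ^ 2) x :=
      ((q n).hasDerivAt x).div ((q (n + 1)).hasDerivAt x) (hSq x hxS)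
    rw [h.deriv]
    refine div_neg_of_neg_of_pos ?_ (sq_pos_iff.2 (hSq x hxS))
    have hp := recurrence_christoffel_darboux_confluent_pos hq0 hq1 hrec hb n x
    linarith

/-- **At most one zero of `q_{n+1}` in a convex set free of zeros of `q_n`.** [Szegő Thm 3.3.2 (proof); this file, §1096] -/
theorem recurrence_succ_zero_unique_of_convex {q : ℕ → ℝ[X]} {a b : ℕ → ℝ} (hq0 : q 0 = 1) (hq1 : q 1 = Polynomial.X - C (a 0))
    (hrec : ∀ n, q (n + 2) = (Polynomial.X - C (a (n + 1))) * q (n + 1) - C (b (n + 1)) * q n) (hb : ∀ j, 0 < b j) (n : ℕ)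
    {S : Set ℝ} (hS : Convex ℝ S) (hSq : ∀ x ∈ S, (q n).eval x ≠ 0) {u v : ℝ} (hu : u ∈ S) (hv : v ∈ S)
    (hqu : (q (n + 1)).eval u = 0) (hqv : (q (n + 1)).eval v = 0) : u = v := by
  have hmono := recurrence_ratio_strictMonoOn hq0 hq1 hrec hb n hS hSq
  have hfu : (q (n + 1)).eval u / (q n).eval u = 0 := by rw [hqu, zero_div]
  have hfv : (q (n + 1)).eval v / (q n).eval v = 0 := by rw [hqv, zero_div]
  exact hmono.injOn hu hv (hfu.trans hfv.symm)

/-- **At most one zero of `q_n` in a convex set free of zeros of `q_{n+1}`.** [this file, §1096] -/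
theorem recurrence_zero_unique_of_convex {q : ℕ → ℝ[X]} {a b : ℕ → ℝ} (hq0 : q 0 = 1) (hq1 : q 1 = Polynomial.X - C (a 0))
    (hrec : ∀ n, q (n + 2) = (Polynomial.X - C (a (n + 1))) * q (n + 1) - C (b (n + 1)) * q n) (hb : ∀ j, 0 < b j) (n : ℕ)
    {S : Set ℝ} (hS : Convex ℝ S) (hSq : ∀ x ∈ S, (q (n + 1)).eval x ≠ 0) {u v : ℝ} (hu : u ∈ S) (hv : v ∈ S)
    (hqu : (q n).eval u = 0) (hqv : (q n).eval v = 0) : u = v := by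
  have hanti := recurrence_inv_ratio_strictAntiOn hq0 hq1 hrec hb n hS hSq
  have hfu : (q n).eval u / (q (n + 1)).eval u = 0 := by rw [hqu, zero_div]
  have hfv : (q n).eval v / (q (n + 1)).eval v = 0 := by rw [hqv, zero_div]
  exact hanti.injOn hu hv (hfu.trans hfv.symm)

end Summit.Ventures.HSemireg.Wedge.HankelOuter
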